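/- Free-seat work of EXTRA WIDTH SEAT `ym-line-cbag-p1-w4` (prover-ym-line-cbag-p1-w4-g2-0), route `EguchiKawaiDirectionLadder`
(ideator ym-idea-2, LINE 8), crux `TripleSmallBallMargin` (stmt-QuantumFields-27724): LEAD's request (F1) (STATUS 15:02:13Z) — the
cross-term bound made LINEAR in the far mass (a block of a unitary is a contraction), and the h1-provider of S9 re-issued with it.
ROUTE-INDEPENDENT.  Nothing here bears on the Yang–Mills mass gap. -/
import Summits.QuantumFields.YangMills.Theorems.EguchiKawaiDirectionLadderBlockPairCross
import HarnessLib

/-!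
# Route `EguchiKawaiDirectionLadder`: linear cross-term bounds (F1) and the block-local robust pair event, linear form

* `sum_norm_sq_mul_le_of_contraction` — `Σ|(AB)_{ij}|² ≤ Σ|A_{ij}|²` whenever `1 − BB†` is positive semidefinite (rectangular shapes;
  `tr(A(1−BB†)A†) ≥ 0`);
* `posSemidef_one_sub_toBlock_gram` — for `Y ∈ U(N)` and any predicates `p, q`: `1 − Y_{pq}Y_{pq}†` is positive semidefinite (Gram identity);
* `sum_norm_sq_crossTerm_le_linear` — `Σ|crossTerm a|² ≤ 2(Σ|X_{ca}|² + Σ|Y_{ca}|²)`: LINEAR in the far row masses of block `c`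
  (the old `…_le_farPairMass` had the product `Σ|X_{ca}|²Σ|Y_{ac}|²`);
* `crossTerms_split_linear`, `blockLocal_robustPair_of_commutatorBlock_small_linear` — the near/far split and the h1-provider of
  `…BlockPairCross` with the linear far bound `2·#far·Σ_{a far} 2(Σ|X_{ca}|² + Σ|Y_{ca}|²)` (no new definitions).

HONEST FRAMING: linear algebra only.  The route bears on the barrier-ledger fact `EguchiKawaiBreakdown` only.
-/

set_option autoImplicit false

noncomputable section

open scoped Matrix ComplexOrder
open Literature.Barriers.QuantumFields

namespace Summit.QuantumFields.YangMills.Theorems.EguchiKawaiDirectionLadder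

/-! ### §1 Multiplication by a contraction does not increase the Frobenius mass -/

section Contraction

variable {β γ δ : Type} [Fintype β] [Fintype γ] [Fintype δ] [DecidableEq γ]

/-- **`Σ|(AB)_{ij}|² ≤ Σ|A_{ij}|²` for a contraction `B`** (`1 − BB† ≥ 0`): `Σ|A|² − Σ|AB|² = Re tr(A(1 − BB†)A†) ≥ 0`. -/
theorem sum_norm_sq_mul_le_of_contraction (A : Matrix β γ ℂ) (B : Matrix γ δ ℂ) (hB : (1 - B * Bᴴ).PosSemidef) :
    ∑ i, ∑ j, ‖(A * B) i j‖ ^ 2 ≤ ∑ i, ∑ j, ‖A i j‖ ^ 2 := by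
  have h1 : ((∑ i, ∑ j, ‖(A * B) i j‖ ^ 2 : ℝ) : ℂ) = Matrix.trace (A * (B * Bᴴ) * Aᴴ) := by
    rw [← trace_mul_conjTranspose_eq_sum, Matrix.conjTranspose_mul]
    congr 1
    simp only [Matrix.mul_assoc]
  have h2 : ((∑ i, ∑ j, ‖A i j‖ ^ 2 : ℝ) : ℂ) = Matrix.trace (A * Aᴴ) := (trace_mul_conjTranspose_eq_sum A).symm
  have hpsd : (A * (1 - B * Bᴴ) * Aᴴ).PosSemidef := hB.mul_mul_conjTranspose_same A
  have htr : 0 ≤ (Matrix.trace (A * (1 - B * Bᴴ) * Aᴴ)).re := by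
    have h := hpsd.trace_nonneg
    rw [RCLike.nonneg_iff] at h
    exact h.1
  have hdiff : Matrix.trace (A * (1 - B * Bᴴ) * Aᴴ) = Matrix.trace (A * Aᴴ) - Matrix.trace (A * (B * Bᴴ) * Aᴴ) := by
    rw [Matrix.mul_sub, Matrix.mul_one, Matrix.sub_mul, Matrix.trace_sub]
  rw [hdiff, ← h1, ← h2, Complex.sub_re, Complex.ofReal_re, Complex.ofReal_re] at htr
  linarith

end Contraction

/-! ### §2 Blocks of a unitary are contractions -/

section Blocks

variable {N m : ℕ}

/-- For `Y ∈ U(N)` and predicates `p, q`: `1 − Y_{pq} Y_{pq}† = Y_{p¬q} Y_{p¬q}† ≥ 0`. -/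
theorem posSemidef_one_sub_toBlock_gram (Y : UN N) (p q : Fin N → Prop) [DecidablePred p] [DecidablePred q] :
    (1 - (Y : Matrix (Fin N) (Fin N) ℂ).toBlock p q * ((Y : Matrix (Fin N) (Fin N) ℂ).toBlock p q)ᴴ).PosSemidef := by
  have h := gram_rows_two Y p q
  have h' : 1 - (Y : Matrix (Fin N) (Fin N) ℂ).toBlock p q * ((Y : Matrix (Fin N) (Fin N) ℂ).toBlock p q)ᴴ =
      (Y : Matrix (Fin N) (Fin N) ℂ).toBlock p (fun i => ¬q i) * ((Y : Matrix (Fin N) (Fin N) ℂ).toBlock p (fun i => ¬q i))ᴴ := by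
    rw [← h]; abel
  rw [h']
  exact Matrix.posSemidef_self_mul_conjTranspose _

/-- A block of a unitary times a unitary block is a contraction: `1 − (Y_{ac}D)(Y_{ac}D)† ≥ 0`. -/
theorem posSemidef_one_sub_toBlock_mul_unitary_gram (ℓ : Fin N → Fin m) (Y : UN N) (V : BlockUnitaries ℓ) (a c : Fin m) :
    (1 - ((Y : Matrix (Fin N) (Fin N) ℂ).toBlock (fun i => ℓ i = a) (fun i => ℓ i = c) *
        (V c : Matrix {i : Fin N // ℓ i = c} {i : Fin N // ℓ i = c} ℂ)) *
      ((Y : Matrix (Fin N) (Fin N) ℂ).toBlock (fun i => ℓ i = a) (fun i => ℓ i = c) *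
        (V c : Matrix {i : Fin N // ℓ i = c} {i : Fin N // ℓ i = c} ℂ))ᴴ).PosSemidef := by
  have hV : (V c : Matrix {i : Fin N // ℓ i = c} {i : Fin N // ℓ i = c} ℂ) *
      (V c : Matrix {i : Fin N // ℓ i = c} {i : Fin N // ℓ i = c} ℂ)ᴴ = 1 := by
    have h := Matrix.mem_unitaryGroup_iff.mp (V c).2
    rwa [Matrix.star_eq_conjTranspose] at h
  have h' : (Y : Matrix (Fin N) (Fin N) ℂ).toBlock (fun i => ℓ i = a) (fun i => ℓ i = c) *
        (V c : Matrix {i : Fin N // ℓ i = c} {i : Fin N // ℓ i = c} ℂ) *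
      ((Y : Matrix (Fin N) (Fin N) ℂ).toBlock (fun i => ℓ i = a) (fun i => ℓ i = c) *
        (V c : Matrix {i : Fin N // ℓ i = c} {i : Fin N // ℓ i = c} ℂ))ᴴ =
      (Y : Matrix (Fin N) (Fin N) ℂ).toBlock (fun i => ℓ i = a) (fun i => ℓ i = c) *
        ((Y : Matrix (Fin N) (Fin N) ℂ).toBlock (fun i => ℓ i = a) (fun i => ℓ i = c))ᴴ := by
    rw [Matrix.conjTranspose_mul, Matrix.mul_assoc,
      ← Matrix.mul_assoc (V c : Matrix {i : Fin N // ℓ i = c} {i : Fin N // ℓ i = c} ℂ), hV, Matrix.one_mul]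
  rw [h']
  exact posSemidef_one_sub_toBlock_gram Y _ _

/-- **Linear cross-term bound (F1)**: `Σ|crossTerm a|² ≤ 2(Σ|X_{ca}|² + Σ|Y_{ca}|²)` for unitary `X, Y` and unitary blocks. -/
theorem sum_norm_sq_crossTerm_le_linear (ℓ : Fin N → Fin m) (X Y : UN N) (V V' : BlockUnitaries ℓ) (c a : Fin m) :
    ∑ i, ∑ j, ‖crossTerm ℓ (X : Matrix (Fin N) (Fin N) ℂ) (Y : Matrix (Fin N) (Fin N) ℂ) V V' c a i j‖ ^ 2 ≤
      2 * ((∑ i, ∑ j, ‖(X : Matrix (Fin N) (Fin N) ℂ).toBlock (fun i => ℓ i = c) (fun i => ℓ i = a) i j‖ ^ 2) +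
        ∑ i, ∑ j, ‖(Y : Matrix (Fin N) (Fin N) ℂ).toBlock (fun i => ℓ i = c) (fun i => ℓ i = a) i j‖ ^ 2) := by
  unfold crossTerm
  have h := sum_norm_sq_sub_le
    ((X : Matrix (Fin N) (Fin N) ℂ).toBlock (fun i => ℓ i = c) (fun i => ℓ i = a) *
        (V a : Matrix {i : Fin N // ℓ i = a} {i : Fin N // ℓ i = a} ℂ) *
      ((Y : Matrix (Fin N) (Fin N) ℂ).toBlock (fun i => ℓ i = a) (fun i => ℓ i = c) *
        (V' c : Matrix {i : Fin N // ℓ i = c} {i : Fin N // ℓ i = c} ℂ)))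
    ((Y : Matrix (Fin N) (Fin N) ℂ).toBlock (fun i => ℓ i = c) (fun i => ℓ i = a) *
        (V' a : Matrix {i : Fin N // ℓ i = a} {i : Fin N // ℓ i = a} ℂ) *
      ((X : Matrix (Fin N) (Fin N) ℂ).toBlock (fun i => ℓ i = a) (fun i => ℓ i = c) *
        (V c : Matrix {i : Fin N // ℓ i = c} {i : Fin N // ℓ i = c} ℂ)))
  have h1 : ∑ i, ∑ j, ‖((X : Matrix (Fin N) (Fin N) ℂ).toBlock (fun i => ℓ i = c) (fun i => ℓ i = a) *
        (V a : Matrix {i : Fin N // ℓ i = a} {i : Fin N // ℓ i = a} ℂ) *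
      ((Y : Matrix (Fin N) (Fin N) ℂ).toBlock (fun i => ℓ i = a) (fun i => ℓ i = c) *
        (V' c : Matrix {i : Fin N // ℓ i = c} {i : Fin N // ℓ i = c} ℂ))) i j‖ ^ 2 ≤
      ∑ i, ∑ j, ‖(X : Matrix (Fin N) (Fin N) ℂ).toBlock (fun i => ℓ i = c) (fun i => ℓ i = a) i j‖ ^ 2 := by
    refine (sum_norm_sq_mul_le_of_contraction _ _ (posSemidef_one_sub_toBlock_mul_unitary_gram ℓ Y V' a c)).trans ?_
    rw [sum_norm_sq_mul_unitary']
  have h2 : ∑ i, ∑ j, ‖((Y : Matrix (Fin N) (Fin N) ℂ).toBlock (fun i => ℓ i = c) (fun i => ℓ i = a) *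
        (V' a : Matrix {i : Fin N // ℓ i = a} {i : Fin N // ℓ i = a} ℂ) *
      ((X : Matrix (Fin N) (Fin N) ℂ).toBlock (fun i => ℓ i = a) (fun i => ℓ i = c) *
        (V c : Matrix {i : Fin N // ℓ i = c} {i : Fin N // ℓ i = c} ℂ))) i j‖ ^ 2 ≤
      ∑ i, ∑ j, ‖(Y : Matrix (Fin N) (Fin N) ℂ).toBlock (fun i => ℓ i = c) (fun i => ℓ i = a) i j‖ ^ 2 := by
    refine (sum_norm_sq_mul_le_of_contraction _ _ (posSemidef_one_sub_toBlock_mul_unitary_gram ℓ X V a c)).trans ?_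
    rw [sum_norm_sq_mul_unitary']
  linarith

/-- **Near/far split, linear far bound**: `Σ_{a≠c} crossTerm a = J + S`, `rank J ≤ 2Σ_{a∈near}#{ℓ=a}`,
`Σ|S|² ≤ 2·#far·Σ_{a far} (Σ|X_{ca}|² + Σ|Y_{ca}|²)`. -/
theorem crossTerms_split_linear (ℓ : Fin N → Fin m) (X Y : UN N) (V V' : BlockUnitaries ℓ) (c : Fin m) (near : Finset (Fin m)) :
    ∃ J S : Matrix {i : Fin N // ℓ i = c} {i : Fin N // ℓ i = c} ℂ,
      ∑ a ∈ Finset.univ.erase c, crossTerm ℓ (X : Matrix (Fin N) (Fin N) ℂ) (Y : Matrix (Fin N) (Fin N) ℂ) V V' c a = J + S ∧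
      J.rank ≤ 2 * ∑ a ∈ near, Fintype.card {i : Fin N // ℓ i = a} ∧
      ∑ i, ∑ j, ‖S i j‖ ^ 2 ≤ 2 * ((Finset.univ.erase c).filter (fun a => a ∉ near)).card *
        ∑ a ∈ (Finset.univ.erase c).filter (fun a => a ∉ near),
          ((∑ i, ∑ j, ‖(X : Matrix (Fin N) (Fin N) ℂ).toBlock (fun i => ℓ i = c) (fun i => ℓ i = a) i j‖ ^ 2) +
            ∑ i, ∑ j, ‖(Y : Matrix (Fin N) (Fin N) ℂ).toBlock (fun i => ℓ i = c) (fun i => ℓ i = a) i j‖ ^ 2) := by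
  classical
  set O : Finset (Fin m) := Finset.univ.erase c with hO
  refine ⟨∑ a ∈ O.filter (fun a => a ∈ near), crossTerm ℓ (X : Matrix (Fin N) (Fin N) ℂ) (Y : Matrix (Fin N) (Fin N) ℂ) V V' c a,
    ∑ a ∈ O.filter (fun a => a ∉ near), crossTerm ℓ (X : Matrix (Fin N) (Fin N) ℂ) (Y : Matrix (Fin N) (Fin N) ℂ) V V' c a,
    ?_, ?_, ?_⟩
  · exact (Finset.sum_filter_add_sum_filter_not O (fun a => a ∈ near) _).symm
  · calc (∑ a ∈ O.filter (fun a => a ∈ near),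
          crossTerm ℓ (X : Matrix (Fin N) (Fin N) ℂ) (Y : Matrix (Fin N) (Fin N) ℂ) V V' c a).rank
        ≤ ∑ a ∈ O.filter (fun a => a ∈ near),
            (crossTerm ℓ (X : Matrix (Fin N) (Fin N) ℂ) (Y : Matrix (Fin N) (Fin N) ℂ) V V' c a).rank := rank_sum_le _ _
      _ ≤ ∑ a ∈ O.filter (fun a => a ∈ near), 2 * Fintype.card {i : Fin N // ℓ i = a} :=
          Finset.sum_le_sum fun a _ => rank_crossTerm_le ℓ _ _ V V' c a
      _ ≤ ∑ a ∈ near, 2 * Fintype.card {i : Fin N // ℓ i = a} :=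
          Finset.sum_le_sum_of_subset fun a ha => (Finset.mem_filter.1 ha).2
      _ = 2 * ∑ a ∈ near, Fintype.card {i : Fin N // ℓ i = a} := by rw [Finset.mul_sum]
  · calc ∑ i, ∑ j, ‖(∑ a ∈ O.filter (fun a => a ∉ near),
            crossTerm ℓ (X : Matrix (Fin N) (Fin N) ℂ) (Y : Matrix (Fin N) (Fin N) ℂ) V V' c a) i j‖ ^ 2
        ≤ (O.filter (fun a => a ∉ near)).card * ∑ a ∈ O.filter (fun a => a ∉ near),
            ∑ i, ∑ j, ‖crossTerm ℓ (X : Matrix (Fin N) (Fin N) ℂ) (Y : Matrix (Fin N) (Fin N) ℂ) V V' c a i j‖ ^ 2 :=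
          sum_norm_sq_finset_sum_le _ _
      _ ≤ (O.filter (fun a => a ∉ near)).card * ∑ a ∈ O.filter (fun a => a ∉ near),
            2 * ((∑ i, ∑ j, ‖(X : Matrix (Fin N) (Fin N) ℂ).toBlock (fun i => ℓ i = c) (fun i => ℓ i = a) i j‖ ^ 2) +
            ∑ i, ∑ j, ‖(Y : Matrix (Fin N) (Fin N) ℂ).toBlock (fun i => ℓ i = c) (fun i => ℓ i = a) i j‖ ^ 2) := by
          gcongr with a _
          exact sum_norm_sq_crossTerm_le_linear ℓ X Y V V' c a
      _ = 2 * (O.filter (fun a => a ∉ near)).card * ∑ a ∈ O.filter (fun a => a ∉ near),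
            ((∑ i, ∑ j, ‖(X : Matrix (Fin N) (Fin N) ℂ).toBlock (fun i => ℓ i = c) (fun i => ℓ i = a) i j‖ ^ 2) +
            ∑ i, ∑ j, ‖(Y : Matrix (Fin N) (Fin N) ℂ).toBlock (fun i => ℓ i = c) (fun i => ℓ i = a) i j‖ ^ 2) := by
          rw [← Finset.mul_sum]; ring

/-- **The block-local robust pair event, linear far bound** (h1-provider, F1 form): if `Σ|([X·ι(D), Y·ι(D′)])_{cc}|² ≤ s` then
`∃ J′`, `rank J′ ≤ 2Σ_{a∈near}#{ℓ=a}`, `Σ|withinPair − J′|² ≤ 2s + 2·(2·#far·Σ_{a far} (Σ|X_{ca}|² + Σ|Y_{ca}|²))`. -/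
theorem blockLocal_robustPair_of_commutatorBlock_small_linear (ℓ : Fin N → Fin m) (X Y : UN N)
    (V V' : BlockUnitaries ℓ) (c : Fin m) (near : Finset (Fin m)) {s : ℝ}
    (hs : ∑ i, ∑ j, ‖((X : Matrix (Fin N) (Fin N) ℂ) *
            blockDiag ℓ (fun a => (V a : Matrix {i : Fin N // ℓ i = a} {i : Fin N // ℓ i = a} ℂ)) *
          ((Y : Matrix (Fin N) (Fin N) ℂ) *
            blockDiag ℓ (fun a => (V' a : Matrix {i : Fin N // ℓ i = a} {i : Fin N // ℓ i = a} ℂ))) -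
        (Y : Matrix (Fin N) (Fin N) ℂ) *
            blockDiag ℓ (fun a => (V' a : Matrix {i : Fin N // ℓ i = a} {i : Fin N // ℓ i = a} ℂ)) *
          ((X : Matrix (Fin N) (Fin N) ℂ) *
            blockDiag ℓ (fun a => (V a : Matrix {i : Fin N // ℓ i = a} {i : Fin N // ℓ i = a} ℂ)))).toBlock
          (fun i => ℓ i = c) (fun i => ℓ i = c) i j‖ ^ 2 ≤ s) :
    ∃ J' : Matrix {i : Fin N // ℓ i = c} {i : Fin N // ℓ i = c} ℂ,
      J'.rank ≤ 2 * ∑ a ∈ near, Fintype.card {i : Fin N // ℓ i = a} ∧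
      ∑ i, ∑ j, ‖(withinPair ℓ (X : Matrix (Fin N) (Fin N) ℂ) (Y : Matrix (Fin N) (Fin N) ℂ) V V' c - J') i j‖ ^ 2 ≤
        2 * s + 2 * (2 * ((Finset.univ.erase c).filter (fun a => a ∉ near)).card *
          ∑ a ∈ (Finset.univ.erase c).filter (fun a => a ∉ near),
            ((∑ i, ∑ j, ‖(X : Matrix (Fin N) (Fin N) ℂ).toBlock (fun i => ℓ i = c) (fun i => ℓ i = a) i j‖ ^ 2) +
            ∑ i, ∑ j, ‖(Y : Matrix (Fin N) (Fin N) ℂ).toBlock (fun i => ℓ i = c) (fun i => ℓ i = a) i j‖ ^ 2)) := by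
  obtain ⟨J, S, hsum, hJ, hS⟩ := crossTerms_split_linear ℓ X Y V V' c near
  have hdec := toBlock_commutator_mul_blockDiag_eq_withinPair_add_sum_crossTerm ℓ (X : Matrix (Fin N) (Fin N) ℂ)
    (Y : Matrix (Fin N) (Fin N) ℂ) V V' c
  rw [hsum] at hdec
  refine ⟨-J, by rw [rank_neg]; exact hJ, ?_⟩
  set B := ((X : Matrix (Fin N) (Fin N) ℂ) *
            blockDiag ℓ (fun a => (V a : Matrix {i : Fin N // ℓ i = a} {i : Fin N // ℓ i = a} ℂ)) *
          ((Y : Matrix (Fin N) (Fin N) ℂ) *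
            blockDiag ℓ (fun a => (V' a : Matrix {i : Fin N // ℓ i = a} {i : Fin N // ℓ i = a} ℂ))) -
        (Y : Matrix (Fin N) (Fin N) ℂ) *
            blockDiag ℓ (fun a => (V' a : Matrix {i : Fin N // ℓ i = a} {i : Fin N // ℓ i = a} ℂ)) *
          ((X : Matrix (Fin N) (Fin N) ℂ) *
            blockDiag ℓ (fun a => (V a : Matrix {i : Fin N // ℓ i = a} {i : Fin N // ℓ i = a} ℂ)))).toBlock
          (fun i => ℓ i = c) (fun i => ℓ i = c) with hB
  have hrew : withinPair ℓ (X : Matrix (Fin N) (Fin N) ℂ) (Y : Matrix (Fin N) (Fin N) ℂ) V V' c - -J = B - S := by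
    rw [hdec]; abel
  rw [hrew]
  have h := sum_norm_sq_sub_le B S
  linarith

end Blocks

end Summit.QuantumFields.YangMills.Theorems.EguchiKawaiDirectionLadder

end
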